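import Literature.NumberTheory.GaloisRepresentations.RamificationFiltrationProofs
import HarnessLib

/-!
# Discharge of `Literature.NumberTheory.GaloisRepresentations.herbrandPsi_monotone`: the inverse Herbrand function `ψ` is monotone (item C9)

D-0014 keeps `Literature/` sorry-free by stating cited results as named facts `def X : Prop`.
This sibling of `Literature.NumberTheory.GaloisRepresentations.RamificationFiltration` (next to
`RamificationFiltrationProofs.lean`, whose `Literature.NumberTheory.GaloisRepresentations.herbrandIntegrand_antitone` and
`Literature.NumberTheory.GaloisRepresentations.inv_card_le_herbrandIntegrand` it reuses) proves the finite-level fact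

* `Literature.NumberTheory.GaloisRepresentations.herbrandPsi_monotone_holds` — for a finite group `G` acting on a commutative ring `S` and
  an ideal `𝔓` of `S`, the inverse Herbrand function `ψ = Literature.herbrandPsi 𝔓 G : ℝ → ℝ` is
  monotone (Serre, *Local Fields*, Ch. IV §3, Prop. 13 a): "`ψ` is continuous, piecewise linear,
  increasing and convex"),

together with `Literature.NumberTheory.GaloisRepresentations.tendsto_herbrandPhi_atTop` (`φ(u) → +∞` as `u → +∞`: the surjectivity half of
Serre's remark that `φ` is a homeomorphism of `[-1, +∞[` onto itself) and the two order-theoretic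
facts about the sublevel sets `{u | φ u ≤ w}` whose suprema define `ψ` in the parent file — they
are nonempty (`Literature.NumberTheory.GaloisRepresentations.herbrandPhi_sublevel_nonempty`) and bounded above
(`Literature.NumberTheory.GaloisRepresentations.bddAbove_herbrandPhi_sublevel`, every real `w`) — which make `sSup` of these sets well
behaved.  Users holding `(h : herbrandPsi_monotone 𝔓 G)` are fed `herbrandPsi_monotone_holds 𝔓 G`.
(`ModPGaloisRepProofs.lean` proves, for its own purposes and for `w ≥ 0` only, the explicit bound
`Literature.NumberTheory.GaloisRepresentations.bddAbove_setOf_herbrandPhi_le` and `Literature.div_card_le_herbrandPhi : u / #G_0 ≤ φ u`; that file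
is not imported here, to keep the Herbrand-function files independent of mod-`p` representations.)

## Proof architecture

Serre (Ch. IV §3, p. 73) sets `φ(u) = ∫₀ᵘ dt / (G_0 : G_t)`, proves (Prop. 12) that `φ` is
continuous, piecewise linear, increasing and concave, observes that `φ` is therefore a
homeomorphism of `[-1, +∞[` onto itself, defines `ψ` as the inverse map and records (Prop. 13 a),
"immediate") that `ψ` is continuous, piecewise linear, increasing and convex.  The parent file
defines `ψ` order-theoretically, `herbrandPsi 𝔓 G v = sSup {u | herbrandPhi 𝔓 G u ≤ v}` (for all
real `v`, with `φ` extended by `φ(u) = u` below `-1`), so that monotonicity of `ψ` is the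
monotonicity of `sSup` along the increasing family of sets `{u | φ u ≤ v}` (Mathlib's
`csSup_le_csSup`), *provided* these sets are nonempty and bounded above:

* nonempty: `φ(u) = u` for `u ≤ 0` (`Literature.NumberTheory.GaloisRepresentations.herbrandPhi_of_nonpos`, parent file), so `min v 0`
  lies in `{u | φ u ≤ v}`;
* bounded above — the formal content of "`φ` maps `[-1, +∞[` *onto* itself": for finite `G`
  the integrand `1/(G_0 : G_{⌈t⌉₊}) = #G_{⌈t⌉₊}/#G_0` is antitone in `t`
  (`Literature.NumberTheory.GaloisRepresentations.herbrandIntegrand_antitone`), hence interval integrable on bounded intervals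
  (Mathlib's `Antitone.intervalIntegrable`), and at least `1/#G_0`
  (`Literature.NumberTheory.GaloisRepresentations.inv_card_le_herbrandIntegrand`), so `φ(u) ≥ u/#G_0` for `u ≥ 0`
  (`intervalIntegral.integral_mono_on`), whence `φ → +∞` along `atTop`
  (`Filter.tendsto_atTop_mono'`); consequently `φ(u) ≤ w` fails for all large `u`.

## References

* J.-P. Serre, *Local Fields*, GTM 67, Springer 1979 (transl. of *Corps locaux*), Ch. IV §3,
  pp. 73–74: definition `φ(u) = ∫₀ᵘ dt/(G_0 : G_t)`; Prop. 12 ("a) The function `φ` is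
  continuous, piecewise linear, increasing, and concave. …"); "The map `φ` is a homeomorphism
  of the half-line `[-1, +∞[` onto itself. Denote by `ψ` … the inverse map."; Prop. 13 ("a) The
  function `ψ` is continuous, piecewise linear, increasing and convex. …"). [SerreLocalFields1979]
-/

noncomputable section

namespace Literature.NumberTheory.GaloisRepresentations

section HerbrandPsiMonotone

open MeasureTheory Filter

variable {S : Type*} [CommRing S] (𝔓 : Ideal S) (G : Type*) [Group G] [MulSemiringAction G S]

/-- For finite `G`, `φ(u) → +∞` as `u → +∞`: the surjectivity half of Serre's "The map `φ` is a
homeomorphism of the half-line `[-1, +∞[` onto itself".  Proof: for `u ≥ 0`,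
`u / #G_0 ≤ φ(u)` — integrate the pointwise bound `1/#G_0 ≤ 1/(G_0 : G_{⌈t⌉₊})`
(`Literature.NumberTheory.GaloisRepresentations.inv_card_le_herbrandIntegrand`) over `[0, u]`, the integrand being antitone
(`Literature.NumberTheory.GaloisRepresentations.herbrandIntegrand_antitone`) and hence interval integrable; the same linear lower bound is
recorded as `Literature.NumberTheory.GaloisRepresentations.div_card_le_herbrandPhi` in `ModPGaloisRepProofs.lean` (not imported here, to
keep the Herbrand-function files independent of mod-`p` representations).
[cite: SerreLocalFields1979, Ch. IV §3, Prop. 12 and the paragraph after it (p. 73)] -/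
theorem tendsto_herbrandPhi_atTop [Finite G] : Tendsto (herbrandPhi 𝔓 G) atTop atTop := by
  have hc : (0 : ℝ) < Nat.card (𝔓.ramificationSubgroup G 0) := Nat.cast_pos.mpr Nat.card_pos
  refine tendsto_atTop_mono' atTop ?_ (tendsto_id.atTop_div_const hc)
  filter_upwards [eventually_ge_atTop (0 : ℝ)] with u hu
  have hint : IntervalIntegrable (herbrandIntegrand 𝔓 G) volume 0 u :=
    (herbrandIntegrand_antitone 𝔓 G).intervalIntegrable
  have h := intervalIntegral.integral_mono_on hu intervalIntegrable_const hint
    fun t _ => inv_card_le_herbrandIntegrand 𝔓 G t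
  rwa [intervalIntegral.integral_const, sub_zero, smul_eq_mul, ← div_eq_mul_inv] at h

/-- For finite `G` and *every* real `w`, the sublevel set `{u | φ u ≤ w}` whose supremum is
`ψ(w)` is bounded above (`φ(u) → +∞`, `Literature.NumberTheory.GaloisRepresentations.tendsto_herbrandPhi_atTop`).  (For `w ≥ 0` an
explicit bound `w · #G_0` is `Literature.NumberTheory.GaloisRepresentations.bddAbove_setOf_herbrandPhi_le` of `ModPGaloisRepProofs.lean`.)
[cite: SerreLocalFields1979, Ch. IV §3, after Prop. 12 (p. 73): `φ` maps `[-1, +∞[` onto itself] -/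
theorem bddAbove_herbrandPhi_sublevel [Finite G] (w : ℝ) :
    BddAbove {u : ℝ | herbrandPhi 𝔓 G u ≤ w} := by
  obtain ⟨N, hN⟩ := eventually_atTop.1 ((tendsto_herbrandPhi_atTop 𝔓 G).eventually_gt_atTop w)
  exact ⟨N, fun u (hu : herbrandPhi 𝔓 G u ≤ w) => le_of_not_gt fun hNu => (hN u hNu.le).not_ge hu⟩

/-- For finite `G` the sublevel set `{u | φ u ≤ v}` whose supremum is `ψ(v)` is nonempty: it
contains `min v 0`, because `φ` is the identity on `(-∞, 0]` (`Literature.NumberTheory.GaloisRepresentations.herbrandPhi_of_nonpos`).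
[cite: SerreLocalFields1979, Ch. IV §3, before Prop. 12 (p. 73): `φ(u) = u` for `-1 ≤ u ≤ 0`] -/
theorem herbrandPhi_sublevel_nonempty [Finite G] (v : ℝ) :
    {u : ℝ | herbrandPhi 𝔓 G u ≤ v}.Nonempty := by
  refine ⟨min v 0, ?_⟩
  show herbrandPhi 𝔓 G (min v 0) ≤ v
  rw [herbrandPhi_of_nonpos 𝔓 (min_le_right v 0)]
  exact min_le_left v 0

/-- **Discharge of `Literature.NumberTheory.GaloisRepresentations.herbrandPsi_monotone`** (Serre, *Local Fields*, Ch. IV §3, Prop. 13 a):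
"The function `ψ` is continuous, piecewise linear, increasing and convex").  For finite `G`,
`ψ = (v ↦ sSup {u | φ u ≤ v})` is monotone: the sublevel sets `{u | φ u ≤ v}` increase with `v`,
are nonempty (`Literature.NumberTheory.GaloisRepresentations.herbrandPhi_sublevel_nonempty`) and bounded above
(`Literature.NumberTheory.GaloisRepresentations.bddAbove_herbrandPhi_sublevel`), so Mathlib's `csSup_le_csSup` applies.
[cite: SerreLocalFields1979, Ch. IV §3 Prop. 13 a) (p. 73)] -/
theorem herbrandPsi_monotone_holds : herbrandPsi_monotone 𝔓 G := by
  intro _ v w hvw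
  show sSup {u : ℝ | herbrandPhi 𝔓 G u ≤ v} ≤ sSup {u : ℝ | herbrandPhi 𝔓 G u ≤ w}
  exact csSup_le_csSup (bddAbove_herbrandPhi_sublevel 𝔓 G w)
    (herbrandPhi_sublevel_nonempty 𝔓 G v) fun u (hu : herbrandPhi 𝔓 G u ≤ v) => hu.trans hvw

end HerbrandPsiMonotone

end Literature.NumberTheory.GaloisRepresentations
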